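import Literature.Analysis.Complex.OkaAnalyticPolyhedron
import Literature.Analysis.Complex.PolydiscApprox
import Literature.Analysis.Complex.PQTypeZeroHolomorphic
import HarnessLib

/-!
# Entire approximation on analytic polyhedra (Hörmander, Thm. 2.7.7 via Thm. 2.7.6 (b))

**Theorem** (`exists_entire_approx_on_analyticPolyhedron`). Let
`K = {z ∈ Δ̄(c,r) : |P_j(z)| ≤ 1, j < m}` be an analytic polyhedron of `ℂ^ι` (`P_j` entire,
`Literature.Analysis.Complex.analyticPolyhedron`) and `h` holomorphic on an open `U ⊇ K`. Then for
every `ε > 0` there is an ENTIRE function `g` on `ℂ^ι` with `‖h - g‖ ≤ ε` on `K`.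

This is Hörmander's Theorem 2.7.7 for the polyhedra of Theorem 2.7.6, with Hörmander's proof:
induction on `m` through `ℂ^{Option ι}`. For `m = 0` (`K` a closed polydisc) take Taylor
polynomials on a slightly larger polydisc (`exists_entire_approx_on_closedPolydisc`, Thm. 2.2.6).
For `m + 1` functions, Oka's transfer (`Literature.Analysis.Complex.oka_transfer`, Lemma 2.7.5 (b)
in bidegree `(0,0)`, fed with the `∂̄`-solvability near the lifted polyhedron `K' × D̄`,
`exists_dbar_potential_nhds_analyticPolyhedron` = Thm. 2.7.6 (a)) extends the `0`-form `h` (cut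
off outside `U`) to a `∂̄`-closed `0`-form `F` near `K' × D̄ ⊆ ℂ^{Option ι}`, i.e. a holomorphic
function there with `F(z, P(z)) = h(z)` on `K`; by induction `F` is approximated on `K' × D̄` by an
entire `G`, and `z ↦ G(z, P(z))` is entire and approximates `h` on `K`.

This is the approximation input (`hA`) of the `∂̄`-exhaustion
`Literature.Analysis.Complex.exists_dbar_potential_of_compactExhaustion` (Thm. 2.7.8, `q = 0`).

## References

* L. Hörmander, *An Introduction to Complex Analysis in Several Variables*, 2nd ed. (1973),
  Thm. 2.7.7, Thm. 2.7.6 (b), Lemma 2.7.5. [HormanderSCV1973]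
-/

noncomputable section

open scoped ContDiff Topology
open Complex Function Set Filter Metric ContinuousAlternatingMap
open Literature.LinearAlgebra.Alternating Literature.NumberTheory.Transcendental

namespace Literature.Analysis.Complex

universe u

section ZeroForms

variable {E : Type*} [NormedAddCommGroup E] [NormedSpace ℂ E]

/-- Every `0`-form has pointwise type `(0,0)`. [folklore] -/
theorem isOfTypeAt_zero_zero (η : E [⋀^Fin 0]→L[ℝ] ℂ) : IsOfTypeAt 0 0 η :=
  ⟨rfl, fun θ v => by
    have h : (fun i => exp (θ * I) • v i) = v := Subsingleton.elim _ _
    rw [h]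
    simp⟩

end ZeroForms

/-- **Entire approximation on analytic polyhedra** (Hörmander (1973), Thm. 2.7.7 for the polyhedra
of Thm. 2.7.6, `P_j` entire): if `h` is holomorphic on an open `U ⊇ K`,
`K = {z ∈ Δ̄(c,r) : |P_j z| ≤ 1}`, then for every `ε > 0` there is an entire `g` with
`‖h x - g x‖ ≤ ε` for `x ∈ K`. Induction on the number of functions through `ℂ^{Option ι}` (Oka's
transfer in bidegree `(0,0)` and Taylor approximation on polydiscs; see the module docstring).
[cite: HormanderSCV1973, Thm. 2.7.7] -/
theorem exists_entire_approx_on_analyticPolyhedron :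
    ∀ (m : ℕ) {ι : Type u} [Fintype ι] [DecidableEq ι] (c : ι → ℂ) (r : ι → ℝ)
      (P : Fin m → (ι → ℂ) → ℂ) (_hP : ∀ j, Differentiable ℂ (P j)) {U : Set (ι → ℂ)}
      (_hU : IsOpen U) (_hKU : analyticPolyhedron c r P ⊆ U) {h : (ι → ℂ) → ℂ}
      (_hh : DifferentiableOn ℂ h U) {ε : ℝ} (_hε : 0 < ε),
      ∃ g : (ι → ℂ) → ℂ, Differentiable ℂ g ∧
        ∀ x ∈ analyticPolyhedron c r P, ‖h x - g x‖ ≤ ε := by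
  intro m
  induction m with
  | zero =>
    intro ι _ _ c r P hP U hU hKU h hh ε hε
    rw [analyticPolyhedron_zero] at hKU ⊢
    by_cases hr : ∀ i, 0 ≤ r i
    · -- Taylor polynomials on a larger polydisc inside `U`
      obtain ⟨δ, hδ, hδU⟩ := exists_polydisc_between hr hU hKU
      obtain ⟨g, hg, hga⟩ := exists_entire_approx_on_closedPolydisc (t := r)
        (r := fun i => r i + δ) (hh.mono hδU) (fun i => lt_add_of_pos_right _ hδ) hε
      exact ⟨g, hg, fun x hx => hga x hx⟩
    · -- a negative radius: the closed polydisc is empty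
      obtain ⟨i, hi⟩ := not_forall.1 hr
      refine ⟨0, differentiable_const _, fun x hx => ?_⟩
      have h1 : ‖x i - c i‖ ≤ r i := (mem_closedPolydisc.1 hx) i
      exact absurd (h1.trans_lt (not_le.1 hi)) (not_lt.2 (norm_nonneg _))
  | succ m ih =>
    intro ι _ _ c r P hP U hU hKU h hh ε hε
    have hKc : IsCompact (analyticPolyhedron c r P) :=
      isCompact_analyticPolyhedron c r fun j => (hP j).continuous
    -- cut `h` off outside `U`
    obtain ⟨χ, hχs, -, hχU, O, hOo, hKO, hO1⟩ := exists_complex_cutoff_nhdsSet hKc hU hKU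
    have hhs : ContDiffOn ℝ ∞ h U := contDiffOn_real_of_differentiableOn hh hU
    set h₁ : (ι → ℂ) → ℂ := fun x => χ x • h x with hh₁
    have hh₁s : ContDiff ℝ ∞ h₁ := contDiff_smul_of_tsupport_subset hU hχs hχU hhs
    -- the `0`-form `F₁ = h₁`
    set e : (ι → ℂ) [⋀^Fin 0]→L[ℝ] ℂ := ContinuousAlternatingMap.constOfIsEmpty ℝ (ι → ℂ) (Fin 0) 1
      with he
    set F₁ : (ι → ℂ) → (ι → ℂ) [⋀^Fin 0]→L[ℝ] ℂ := fun x => h₁ x • e with hF₁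
    have hF₁s : ContDiff ℝ ∞ F₁ := hh₁s.smul contDiff_const
    have hF₁t : ∀ x, IsOfTypeAt 0 0 (F₁ x) := fun x => isOfTypeAt_zero_zero _
    have hGO : ∀ x ∈ O ∩ U, typeProjAt 0 (0 + 1) (extDeriv F₁ x) = 0 := by
      intro x hx
      have hev : h₁ =ᶠ[𝓝 x] h := by
        filter_upwards [(hOo.inter hU).mem_nhds hx] with y hy
        simp [hh₁, hO1 y hy.1]
      have hhx : DifferentiableAt ℂ h x := hh.differentiableAt (hU.mem_nhds hx.2)
      have hh₁x : DifferentiableAt ℂ h₁ x := hhx.congr_of_eventuallyEq hev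
      have hF₁x : DifferentiableAt ℂ F₁ x := hh₁x.smul_const e
      rw [typeProjAt_extDeriv_eq_sum hF₁t]
      refine Finset.sum_eq_zero fun j _ => ?_
      rw [dbarAlong_eq_zero_of_differentiableAt hF₁x, wedgeOne_zero]
    -- Oka's transfer, with `∂̄`-solvability near the lifted polyhedron from Thm. 2.7.6 (a)
    obtain ⟨U₁, hU₁o, hKU₁, F₂, hF₂s, hF₂t, hF₂c, hF₂F₁⟩ :=
      oka_transfer c r P hP (N := 0) (p := 0) (s := 0) rfl
        (fun {W} hW hKW {g} hg hgt hgc => exists_dbar_potential_nhds_analyticPolyhedron m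
          (optCentre c) (optRadius r) (optFun P) (differentiable_optFun hP) hW hKW hg hgt hgc)
        hF₁s hF₁t (hOo.inter hU) (subset_inter hKO hKU) hGO
    -- the holomorphic function `f₂ = F₂(·)()` on `U₁`
    set v0 : Fin 0 → (Option ι → ℂ) := fun i => i.elim0 with hv0
    let ev : ((Option ι → ℂ) [⋀^Fin 0]→L[ℝ] ℂ) →L[ℂ] ℂ :=
      { toFun := fun η => η v0
        map_add' := fun _ _ => rfl
        map_smul' := fun _ _ => rfl
        cont := continuous_eval_const v0 }
    have hF₂hol : DifferentiableOn ℂ F₂ U₁ :=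
      differentiableOn_complex_of_typeZero (p := 0) hU₁o (hF₂s.differentiableOn (by simp)) hF₂t hF₂c
    set f₂ : (Option ι → ℂ) → ℂ := fun y => F₂ y v0 with hf₂
    have hf₂h : DifferentiableOn ℂ f₂ U₁ := ev.differentiable.comp_differentiableOn hF₂hol
    -- induction hypothesis in `ℂ^{Option ι}`
    obtain ⟨g₂, hg₂, hg₂a⟩ := ih (optCentre c) (optRadius r) (optFun P) (differentiable_optFun hP)
      hU₁o hKU₁ hf₂h hε
    refine ⟨g₂ ∘ optEmbed (P (Fin.last m)), hg₂.comp (differentiable_optEmbed (hP _)),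
      fun z hz => ?_⟩
    have hz' := optEmbed_mem_analyticPolyhedron_opt hz
    -- `h z = f₂ (Φ z)` from `Φ^*F₂ = F₁`
    have hval : f₂ (optEmbed (P (Fin.last m)) z) = h z := by
      have h1 : flatPullback (optEmbed (P (Fin.last m))) F₂ z (fun i => i.elim0) =
          F₁ z (fun i => i.elim0) := by rw [hF₂F₁ z]
      have h3 : flatPullback (optEmbed (P (Fin.last m))) F₂ z (fun i => i.elim0) =
          f₂ (optEmbed (P (Fin.last m)) z) := by
        rw [flatPullback_apply, ContinuousAlternatingMap.compContinuousLinearMap_apply]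
        exact congrArg _ (Subsingleton.elim _ _)
      rw [← h3, h1]
      simp [hF₁, he, hh₁, hO1 z (hKO hz)]
    calc ‖h z - (g₂ ∘ optEmbed (P (Fin.last m))) z‖
        = ‖f₂ (optEmbed (P (Fin.last m)) z) - g₂ (optEmbed (P (Fin.last m)) z)‖ := by
          rw [hval]; rfl
      _ ≤ ε := hg₂a _ hz'

end Literature.Analysis.Complex
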